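import Summits.CriticalPhenomena.PercolationContinuityZ3.Theorems.Transplant.FKDoubleFanOneSided
import HarnessLib

/-!
# Double fans, MULTIFAN₁ middles: the certificate for the CORE-sized endpoint polynomial `𝒞₁` of LEMMA‴, part B

Helper file (`--supports stmt-CriticalPhenomena-4575`), FK sub-lane `prim-bschramm-fk-3` (gen 34); builds on p205010 (kernel theorem, internal audit
signed; external expert review pending).  Pure real polynomial algebra, no sorries; standard axioms.  Memo `bschramm/prim-bschramm-fk-3/FAR-CROSS-IX.md` §6–§6g.

Companion of `…MultifanC2Cert*`: the `Z_f·y_f` coefficient `𝒞₁` (368 terms) of the floor×roof³ endpoint cell of the four-leg Rayleigh difference of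
`…DoubleFanMultifan` satisfies `𝒞₁ = 4(1−q)²·[(α + m₁)² + q·t_g·α²] + Σ_e t^e·R_e` with `α = t_s w_g + t_u(w_g − w_s)`,
`m₁ = w_g(1−w_s)(1−w_u) − w_s w_u(1−w_g)`; this file and its companions certify the twenty `R_e ≥ 0` on `[0,1]⁴` (tensor-Bernstein expansions, exact
`(w−w′)²`-splits found by linear programming, and — for `R₁₀₁`, which vanishes on the segments `{q=1, w_u=1, w_s=0}` and `{w_u=0, w_g=0}` and has no
Bernstein certificate — a quadratic-Bernstein-in-`w_g` argument with a discriminant bound certified by a Positivstellensatz multiplier).  This file: `mfConeR012`, `mfConeR020`, `mfConeR021`, `mfConeR100`, `mfConeR101`, `mfConeR102`, `mfConeR110`.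
[folklore]
-/

noncomputable section

namespace Summit.CriticalPhenomena.PercolationContinuityZ3.Theorems

namespace FK

namespace ThreeApex

/-- Remainder coefficient of `t_g^0 t_u^1 t_s^2` in the `𝒞₁` certificate (polynomial in `q, wg, wu`). [folklore] -/
def mfConeR012 (q wg wu : ℝ) : ℝ :=
  (1 : ℝ) * q ^ 4 * wg ^ 2 * wu ^ 2 + ((-4) : ℝ) * q ^ 3 * wg ^ 2 * wu ^ 2 + ((-2) : ℝ) * q ^ 4 * wg ^ 2 * wu + (4 : ℝ) * q ^ 2 * wg ^ 2 * wu ^ 2 + (8 : ℝ) * q ^ 3 * wg ^ 2 * wu +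
    ((-8) : ℝ) * q ^ 2 * wg ^ 2 * wu + (1 : ℝ) * q ^ 3 * wg ^ 2 + ((-4) : ℝ) * q ^ 2 * wg ^ 2 + (4 : ℝ) * q * wg ^ 2

/-- Remainder coefficient of `t_g^0 t_u^2 t_s^0` in the `𝒞₁` certificate (polynomial in `q, wg, ws`). [folklore] -/
def mfConeR020 (q wg ws : ℝ) : ℝ :=
  ((-2) : ℝ) * q ^ 2 * wg ^ 2 * ws ^ 2 + (4 : ℝ) * q * wg ^ 2 * ws ^ 2 + (2 : ℝ) * q ^ 2 * wg * ws ^ 2 + (2 : ℝ) * q ^ 2 * wg ^ 2 * ws + ((-4) : ℝ) * q * wg * ws ^ 2 +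
    ((-4) : ℝ) * q * wg ^ 2 * ws + (4 : ℝ) * q ^ 2 * wg * ws + ((-3) : ℝ) * q ^ 2 * wg ^ 2 + ((-3) : ℝ) * q ^ 2 * ws ^ 2 + ((-4) : ℝ) * q * wg * ws + (4 : ℝ) * q * wg ^ 2 +
    (4 : ℝ) * q * ws ^ 2

/-- Remainder coefficient of `t_g^0 t_u^2 t_s^1` in the `𝒞₁` certificate (polynomial in `q, wg, ws`). [folklore] -/
def mfConeR021 (q wg ws : ℝ) : ℝ :=
  ((-2) : ℝ) * q ^ 3 * wg ^ 2 * ws ^ 2 + (4 : ℝ) * q ^ 2 * wg ^ 2 * ws ^ 2 + (2 : ℝ) * q ^ 3 * wg * ws ^ 2 + (2 : ℝ) * q ^ 3 * wg ^ 2 * ws + ((-4) : ℝ) * q ^ 2 * wg * ws ^ 2 +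
    ((-4) : ℝ) * q ^ 2 * wg ^ 2 * ws + ((-4) : ℝ) * q ^ 3 * wg * ws + (1 : ℝ) * q ^ 3 * wg ^ 2 + (1 : ℝ) * q ^ 3 * ws ^ 2 + (12 : ℝ) * q ^ 2 * wg * ws + ((-4) : ℝ) * q ^ 2 * wg ^ 2 +
    ((-4) : ℝ) * q ^ 2 * ws ^ 2 + ((-8) : ℝ) * q * wg * ws + (4 : ℝ) * q * wg ^ 2 + (4 : ℝ) * q * ws ^ 2

/-- Remainder coefficient of `t_g^1 t_u^0 t_s^0` in the `𝒞₁` certificate (polynomial in `q, wg, wu, ws`). [folklore] -/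
def mfConeR100 (q wg wu ws : ℝ) : ℝ :=
  (2 : ℝ) * q ^ 3 * wg ^ 2 * ws ^ 2 * wu ^ 2 + ((-8) : ℝ) * q ^ 2 * wg ^ 2 * ws ^ 2 * wu ^ 2 + ((-2) : ℝ) * q ^ 3 * wg ^ 2 * ws ^ 2 * wu + (4 : ℝ) * q ^ 2 * wg * ws ^ 2 * wu ^ 2 +
    (4 : ℝ) * q ^ 2 * wg ^ 2 * ws * wu ^ 2 + (8 : ℝ) * q ^ 2 * wg ^ 2 * ws ^ 2 * wu + ((-1) : ℝ) * q ^ 3 * wg ^ 2 * ws ^ 2 + ((-1) : ℝ) * q ^ 3 * wg ^ 2 * wu ^ 2 +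
    ((-1) : ℝ) * q ^ 3 * ws ^ 2 * wu ^ 2 + ((-8) : ℝ) * q ^ 2 * wg * ws * wu ^ 2 + ((-4) : ℝ) * q ^ 2 * wg * ws ^ 2 * wu + ((-4) : ℝ) * q ^ 2 * wg ^ 2 * ws * wu +
    (4 : ℝ) * q ^ 2 * wg ^ 2 * ws ^ 2 + (4 : ℝ) * q ^ 2 * wg ^ 2 * wu ^ 2 + (5 : ℝ) * q ^ 2 * ws ^ 2 * wu ^ 2 + (2 : ℝ) * q ^ 3 * ws ^ 2 * wu + (8 : ℝ) * q * wg * ws * wu ^ 2 +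
    ((-4) : ℝ) * q * wg ^ 2 * ws ^ 2 + ((-4) : ℝ) * q * wg ^ 2 * wu ^ 2 + ((-8) : ℝ) * q * ws ^ 2 * wu ^ 2 + (8 : ℝ) * q ^ 2 * wg * ws * wu + ((-8) : ℝ) * q ^ 2 * ws ^ 2 * wu +
    (1 : ℝ) * q ^ 3 * wg ^ 2 + ((-8) : ℝ) * q * wg * ws * wu + (8 : ℝ) * q * ws ^ 2 * wu + ((-4) : ℝ) * q ^ 2 * wg ^ 2 + (4 : ℝ) * ws ^ 2 * wu ^ 2 + (4 : ℝ) * q * wg ^ 2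

/-- Remainder coefficient of `t_g^1 t_u^0 t_s^1` in the `𝒞₁` certificate (polynomial in `q, wg, wu, ws`). [folklore] -/
def mfConeR101 (q wg wu ws : ℝ) : ℝ :=
  (2 : ℝ) * q ^ 3 * wg ^ 2 * ws ^ 2 * wu ^ 2 + ((-8) : ℝ) * q ^ 2 * wg ^ 2 * ws ^ 2 * wu ^ 2 + ((-2) : ℝ) * q ^ 3 * wg ^ 2 * ws ^ 2 * wu + (1 : ℝ) * q ^ 4 * wg ^ 2 * wu ^ 2 +
    ((-1) : ℝ) * q ^ 4 * ws ^ 2 * wu ^ 2 + (4 : ℝ) * q ^ 2 * wg * ws ^ 2 * wu ^ 2 + (4 : ℝ) * q ^ 2 * wg ^ 2 * ws * wu ^ 2 + (8 : ℝ) * q ^ 2 * wg ^ 2 * ws ^ 2 * wu +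
    ((-1) : ℝ) * q ^ 3 * wg ^ 2 * ws ^ 2 + ((-5) : ℝ) * q ^ 3 * wg ^ 2 * wu ^ 2 + (5 : ℝ) * q ^ 3 * ws ^ 2 * wu ^ 2 + ((-2) : ℝ) * q ^ 4 * wg ^ 2 * wu +
    (2 : ℝ) * q ^ 4 * ws ^ 2 * wu + ((-8) : ℝ) * q ^ 2 * wg * ws * wu ^ 2 + ((-4) : ℝ) * q ^ 2 * wg * ws ^ 2 * wu + ((-4) : ℝ) * q ^ 2 * wg ^ 2 * ws * wu +
    (4 : ℝ) * q ^ 2 * wg ^ 2 * ws ^ 2 + (8 : ℝ) * q ^ 2 * wg ^ 2 * wu ^ 2 + ((-8) : ℝ) * q ^ 2 * ws ^ 2 * wu ^ 2 + (8 : ℝ) * q ^ 3 * wg ^ 2 * wu + ((-8) : ℝ) * q ^ 3 * ws ^ 2 * wu +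
    (8 : ℝ) * q * wg * ws * wu ^ 2 + ((-4) : ℝ) * q * wg ^ 2 * ws ^ 2 + ((-4) : ℝ) * q * wg ^ 2 * wu ^ 2 + (4 : ℝ) * q * ws ^ 2 * wu ^ 2 + (8 : ℝ) * q ^ 2 * wg * ws * wu +
    ((-8) : ℝ) * q ^ 2 * wg ^ 2 * wu + (8 : ℝ) * q ^ 2 * ws ^ 2 * wu + (2 : ℝ) * q ^ 3 * wg ^ 2 + ((-8) : ℝ) * q * wg * ws * wu + ((-8) : ℝ) * q ^ 2 * wg ^ 2 + (8 : ℝ) * q * wg ^ 2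

/-- Auxiliary for `mfConeR101`: the value `Q(w_g = 1)` of `mfConeR101/q` (polynomial in `q, w_u, w_s`). [folklore] -/
def mfConeQone (q wu ws : ℝ) : ℝ :=
  ((-1) : ℝ) * q ^ 3 * ws ^ 2 * wu ^ 2 + (7 : ℝ) * q ^ 2 * ws ^ 2 * wu ^ 2 + (2 : ℝ) * q ^ 3 * ws ^ 2 * wu + ((-12) : ℝ) * q * ws ^ 2 * wu ^ 2 + ((-10) : ℝ) * q ^ 2 * ws ^ 2 * wu +
    (1 : ℝ) * q ^ 3 * wu ^ 2 + ((-4) : ℝ) * q * ws * wu ^ 2 + (12 : ℝ) * q * ws ^ 2 * wu + ((-1) : ℝ) * q ^ 2 * ws ^ 2 + ((-5) : ℝ) * q ^ 2 * wu ^ 2 + ((-2) : ℝ) * q ^ 3 * wu +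
    (4 : ℝ) * ws ^ 2 * wu ^ 2 + (4 : ℝ) * q * ws * wu + (4 : ℝ) * q * ws ^ 2 + (8 : ℝ) * q * wu ^ 2 + (8 : ℝ) * q ^ 2 * wu + (8 : ℝ) * ws * wu ^ 2 + ((-8) : ℝ) * q * wu +
    (2 : ℝ) * q ^ 2 + ((-8) : ℝ) * ws * wu + ((-4) : ℝ) * ws ^ 2 + ((-4) : ℝ) * wu ^ 2 + ((-8) : ℝ) * q + (8 : ℝ)

/-- Auxiliary for `mfConeR101`: `E = D′ + 4w_u²·M` (discriminant plus Positivstellensatz multiplier; polynomial in `q, w_u, w_s`). [folklore] -/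
def mfConeE (q wu ws : ℝ) : ℝ :=
  ((-2) : ℝ) * q ^ 5 * ws ^ 2 * wu ^ 3 + (18 : ℝ) * q ^ 4 * ws ^ 2 * wu ^ 3 + (6 : ℝ) * q ^ 5 * ws ^ 2 * wu ^ 2 + ((-1) : ℝ) * q ^ 6 * wu ^ 3 + ((-56) : ℝ) * q ^ 3 * ws ^ 2 * wu ^ 3 +
    ((-4) : ℝ) * q ^ 4 * ws * wu ^ 3 + ((-50) : ℝ) * q ^ 4 * ws ^ 2 * wu ^ 2 + ((-3) : ℝ) * q ^ 5 * ws ^ 2 * wu + (10 : ℝ) * q ^ 5 * wu ^ 3 + (4 : ℝ) * q ^ 6 * wu ^ 2 +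
    (68 : ℝ) * q ^ 2 * ws ^ 2 * wu ^ 3 + (16 : ℝ) * q ^ 3 * ws * wu ^ 3 + (136 : ℝ) * q ^ 3 * ws ^ 2 * wu ^ 2 + (12 : ℝ) * q ^ 4 * ws * wu ^ 2 + (23 : ℝ) * q ^ 4 * ws ^ 2 * wu +
    ((-41) : ℝ) * q ^ 4 * wu ^ 3 + ((-2) : ℝ) * q ^ 5 * ws ^ 2 + ((-36) : ℝ) * q ^ 5 * wu ^ 2 + ((-4) : ℝ) * q ^ 6 * wu + ((-32) : ℝ) * q * ws ^ 2 * wu ^ 3 +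
    (4 : ℝ) * q ^ 2 * ws * wu ^ 3 + ((-128) : ℝ) * q ^ 2 * ws ^ 2 * wu ^ 2 + ((-44) : ℝ) * q ^ 3 * ws * wu ^ 2 + ((-48) : ℝ) * q ^ 3 * ws ^ 2 * wu + (88 : ℝ) * q ^ 3 * wu ^ 3 +
    ((-8) : ℝ) * q ^ 4 * ws * wu + (16 : ℝ) * q ^ 4 * ws ^ 2 + (128 : ℝ) * q ^ 4 * wu ^ 2 + (30 : ℝ) * q ^ 5 * wu + ((-24) : ℝ) * q * ws * wu ^ 3 + (32 : ℝ) * q * ws ^ 2 * wu ^ 2 +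
    (4 : ℝ) * q ^ 2 * ws ^ 2 * wu + ((-120) : ℝ) * q ^ 2 * wu ^ 3 + (32 : ℝ) * q ^ 3 * ws * wu + ((-48) : ℝ) * q ^ 3 * ws ^ 2 + ((-224) : ℝ) * q ^ 3 * wu ^ 2 +
    ((-78) : ℝ) * q ^ 4 * wu + (4 : ℝ) * q ^ 5 + (40 : ℝ) * q * ws * wu ^ 2 + (48 : ℝ) * q * ws ^ 2 * wu + (80 : ℝ) * q * wu ^ 3 + ((-16) : ℝ) * q ^ 2 * ws * wu +
    (64 : ℝ) * q ^ 2 * ws ^ 2 + (224 : ℝ) * q ^ 2 * wu ^ 2 + (64 : ℝ) * q ^ 3 * wu + ((-32) : ℝ) * q ^ 4 + (16 : ℝ) * ws * wu ^ 3 + ((-16) : ℝ) * q * ws * wu +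
    ((-32) : ℝ) * q * ws ^ 2 + ((-112) : ℝ) * q * wu ^ 2 + (32 : ℝ) * q ^ 2 * wu + (96 : ℝ) * q ^ 3 + ((-16) : ℝ) * ws ^ 2 * wu + ((-16) : ℝ) * wu ^ 3 + ((-64) : ℝ) * q * wu +
    ((-128) : ℝ) * q ^ 2 + (16 : ℝ) * wu ^ 2 + (64 : ℝ) * q + (16 : ℝ) * wu

/-- Remainder coefficient of `t_g^1 t_u^0 t_s^2` in the `𝒞₁` certificate (polynomial in `q, wg, wu`). [folklore] -/
def mfConeR102 (q wg wu : ℝ) : ℝ :=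
  (1 : ℝ) * q ^ 4 * wg ^ 2 * wu ^ 2 + ((-4) : ℝ) * q ^ 3 * wg ^ 2 * wu ^ 2 + ((-2) : ℝ) * q ^ 4 * wg ^ 2 * wu + (4 : ℝ) * q ^ 2 * wg ^ 2 * wu ^ 2 + (8 : ℝ) * q ^ 3 * wg ^ 2 * wu +
    ((-8) : ℝ) * q ^ 2 * wg ^ 2 * wu + ((-3) : ℝ) * q ^ 3 * wg ^ 2 + (4 : ℝ) * q ^ 2 * wg ^ 2

/-- Remainder coefficient of `t_g^1 t_u^1 t_s^0` in the `𝒞₁` certificate (polynomial in `q, wg, wu, ws`). [folklore] -/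
def mfConeR110 (q wg wu ws : ℝ) : ℝ :=
  (2 : ℝ) * q ^ 3 * wg ^ 2 * ws ^ 2 * wu ^ 2 + ((-8) : ℝ) * q ^ 2 * wg ^ 2 * ws ^ 2 * wu ^ 2 + ((-2) : ℝ) * q ^ 3 * wg ^ 2 * ws ^ 2 * wu + (4 : ℝ) * q ^ 2 * wg * ws ^ 2 * wu ^ 2 +
    (4 : ℝ) * q ^ 2 * wg ^ 2 * ws * wu ^ 2 + (8 : ℝ) * q ^ 2 * wg ^ 2 * ws ^ 2 * wu + ((-3) : ℝ) * q ^ 3 * wg ^ 2 * ws ^ 2 + ((-1) : ℝ) * q ^ 3 * wg ^ 2 * wu ^ 2 +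
    ((-8) : ℝ) * q ^ 2 * wg * ws * wu ^ 2 + ((-4) : ℝ) * q ^ 2 * wg * ws ^ 2 * wu + ((-4) : ℝ) * q ^ 2 * wg ^ 2 * ws * wu + (8 : ℝ) * q ^ 2 * wg ^ 2 * ws ^ 2 +
    (4 : ℝ) * q ^ 2 * wg ^ 2 * wu ^ 2 + (2 : ℝ) * q ^ 3 * wg * ws ^ 2 + (2 : ℝ) * q ^ 3 * wg ^ 2 * ws + (2 : ℝ) * q ^ 3 * ws ^ 2 * wu + (8 : ℝ) * q * wg * ws * wu ^ 2 +
    ((-4) : ℝ) * q * wg ^ 2 * ws ^ 2 + ((-4) : ℝ) * q * wg ^ 2 * wu ^ 2 + (8 : ℝ) * q ^ 2 * wg * ws * wu + ((-4) : ℝ) * q ^ 2 * wg * ws ^ 2 + ((-4) : ℝ) * q ^ 2 * wg ^ 2 * ws +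
    ((-8) : ℝ) * q ^ 2 * ws ^ 2 * wu + ((-4) : ℝ) * q ^ 3 * wg * ws + (2 : ℝ) * q ^ 3 * wg ^ 2 + (1 : ℝ) * q ^ 3 * ws ^ 2 + ((-8) : ℝ) * q * wg * ws * wu +
    (8 : ℝ) * q * ws ^ 2 * wu + (12 : ℝ) * q ^ 2 * wg * ws + ((-8) : ℝ) * q ^ 2 * wg ^ 2 + ((-4) : ℝ) * q ^ 2 * ws ^ 2 + ((-8) : ℝ) * q * wg * ws + (8 : ℝ) * q * wg ^ 2 +
    (4 : ℝ) * q * ws ^ 2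

set_option maxHeartbeats 1500000 in
/-- `mfConeR012 ≥ 0` on the box `q, w_g, w_u, w_s ∈ [0,1]` (explicit non-negative certificate, checked by `ring` + `positivity`). [folklore] -/
theorem mfConeR012_nonneg {q wg wu : ℝ} (hq0 : 0 ≤ q) (hq1 : q ≤ 1) (hwu0 : 0 ≤ wu) (hwu1 : wu ≤ 1) : 0 ≤ mfConeR012 q wg wu := by
  have hq1' : (0:ℝ) ≤ 1 - q := sub_nonneg.2 hq1
  have hwu1' : (0:ℝ) ≤ 1 - wu := sub_nonneg.2 hwu1
  have e : mfConeR012 q wg wu =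
      (4 : ℝ) * q * (1 - q) ^ 3 * wg ^ 2 * (1 - wu) ^ 2 + (8 : ℝ) * q * (1 - q) ^ 3 * wg ^ 2 * wu * (1 - wu) + (4 : ℝ) * q * (1 - q) ^ 3 * wg ^ 2 * wu ^ 2 +
      (8 : ℝ) * q ^ 2 * (1 - q) ^ 2 * wg ^ 2 * (1 - wu) ^ 2 + (8 : ℝ) * q ^ 2 * (1 - q) ^ 2 * wg ^ 2 * wu * (1 - wu) + (4 : ℝ) * q ^ 2 * (1 - q) ^ 2 * wg ^ 2 * wu ^ 2 +
      (5 : ℝ) * q ^ 3 * (1 - q) * wg ^ 2 * (1 - wu) ^ 2 + (2 : ℝ) * q ^ 3 * (1 - q) * wg ^ 2 * wu * (1 - wu) + (1 : ℝ) * q ^ 3 * (1 - q) * wg ^ 2 * wu ^ 2 +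
      (1 : ℝ) * q ^ 4 * wg ^ 2 * (1 - wu) ^ 2 := by
    simp only [mfConeR012]; ring
  rw [e]; positivity

set_option maxHeartbeats 1500000 in
/-- `mfConeR020 ≥ 0` on the box `q, w_g, w_u, w_s ∈ [0,1]` (explicit non-negative certificate, checked by `ring` + `positivity`). [folklore] -/
theorem mfConeR020_nonneg {q wg ws : ℝ} (hq0 : 0 ≤ q) (hq1 : q ≤ 1) : 0 ≤ mfConeR020 q wg ws := by
  have hq1' : (0:ℝ) ≤ 1 - q := sub_nonneg.2 hq1
  have e : mfConeR020 q wg ws =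
      (2 : ℝ) * (wg - ws) ^ 2 * q * (1 - q) * (1:ℝ) + (2 : ℝ) * (wg - ws) ^ 2 * q * (1 - q) * (0:ℝ) + (2 : ℝ) * q * (1 - q) * (1 - wg) ^ 2 * ws ^ 2 +
      (2 : ℝ) * q * (1 - q) * wg ^ 2 * (1 - ws) ^ 2 + (1 : ℝ) * q ^ 2 * (1 - wg) ^ 2 * ws ^ 2 + (1 : ℝ) * q ^ 2 * wg ^ 2 * (1 - ws) ^ 2 := by
    simp only [mfConeR020]; ring
  rw [e]; positivity

set_option maxHeartbeats 1500000 in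
/-- `mfConeR021 ≥ 0` on the box `q, w_g, w_u, w_s ∈ [0,1]` (explicit non-negative certificate, checked by `ring` + `positivity`). [folklore] -/
theorem mfConeR021_nonneg {q wg ws : ℝ} (hq0 : 0 ≤ q) (hq1 : q ≤ 1) : 0 ≤ mfConeR021 q wg ws := by
  have hq1' : (0:ℝ) ≤ 1 - q := sub_nonneg.2 hq1
  have e : mfConeR021 q wg ws =
      (4 : ℝ) * (wg - ws) ^ 2 * q * (1 - q) ^ 2 * (1:ℝ) + (4 : ℝ) * (wg - ws) ^ 2 * q * (1 - q) ^ 2 * (0:ℝ) + (2 : ℝ) * (wg - ws) ^ 2 * q ^ 2 * (1 - q) * (1:ℝ) +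
      (2 : ℝ) * (wg - ws) ^ 2 * q ^ 2 * (1 - q) * (0:ℝ) + (2 : ℝ) * q ^ 2 * (1 - q) * (1 - wg) ^ 2 * ws ^ 2 + (2 : ℝ) * q ^ 2 * (1 - q) * wg ^ 2 * (1 - ws) ^ 2 +
      (1 : ℝ) * q ^ 3 * (1 - wg) ^ 2 * ws ^ 2 + (1 : ℝ) * q ^ 3 * wg ^ 2 * (1 - ws) ^ 2 := by
    simp only [mfConeR021]; ring
  rw [e]; positivity

set_option maxHeartbeats 1500000 in
/-- `mfConeR100 ≥ 0` on the box `q, w_g, w_u, w_s ∈ [0,1]` (explicit non-negative certificate, checked by `ring` + `positivity`). [folklore] -/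
theorem mfConeR100_nonneg {q wg wu ws : ℝ} (hq0 : 0 ≤ q) (hq1 : q ≤ 1) (hwg0 : 0 ≤ wg) (hwg1 : wg ≤ 1) (hwu0 : 0 ≤ wu) (hwu1 : wu ≤ 1) (hws0 : 0 ≤ ws) (hws1 : ws ≤ 1) : 0 ≤ mfConeR100 q wg wu ws := by
  have hq1' : (0:ℝ) ≤ 1 - q := sub_nonneg.2 hq1
  have hwg1' : (0:ℝ) ≤ 1 - wg := sub_nonneg.2 hwg1
  have hwu1' : (0:ℝ) ≤ 1 - wu := sub_nonneg.2 hwu1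
  have hws1' : (0:ℝ) ≤ 1 - ws := sub_nonneg.2 hws1
  have e : mfConeR100 q wg wu ws =
      (4 : ℝ) * (wg - ws) ^ 2 * q * (1 - q) ^ 2 * wu * (1 - wu) + (4 : ℝ) * (wg - ws) ^ 2 * q ^ 2 * (1 - q) * wu * (1 - wu) + (4 : ℝ) * (1 - q) ^ 3 * (1 - wg) ^ 2 * wu ^ 2 * ws ^ 2 +
      (8 : ℝ) * (1 - q) ^ 3 * wg * (1 - wg) * wu ^ 2 * ws ^ 2 + (4 : ℝ) * (1 - q) ^ 3 * wg ^ 2 * wu ^ 2 * ws ^ 2 + (4 : ℝ) * q * (1 - q) ^ 2 * (1 - wg) ^ 2 * wu * (1 - wu) * ws ^ 2 +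
      (12 : ℝ) * q * (1 - q) ^ 2 * (1 - wg) ^ 2 * wu ^ 2 * ws ^ 2 + (8 : ℝ) * q * (1 - q) ^ 2 * wg * (1 - wg) * wu * (1 - wu) * ws ^ 2 +
      (24 : ℝ) * q * (1 - q) ^ 2 * wg * (1 - wg) * wu ^ 2 * ws ^ 2 + (4 : ℝ) * q * (1 - q) ^ 2 * wg ^ 2 * (1 - wu) ^ 2 * (1 - ws) ^ 2 +
      (8 : ℝ) * q * (1 - q) ^ 2 * wg ^ 2 * (1 - wu) ^ 2 * ws * (1 - ws) + (4 : ℝ) * q * (1 - q) ^ 2 * wg ^ 2 * wu * (1 - wu) * (1 - ws) ^ 2 +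
      (8 : ℝ) * q * (1 - q) ^ 2 * wg ^ 2 * wu * (1 - wu) * ws * (1 - ws) + (8 : ℝ) * q * (1 - q) ^ 2 * wg ^ 2 * wu ^ 2 * ws ^ 2 +
      (4 : ℝ) * q ^ 2 * (1 - q) * (1 - wg) ^ 2 * wu * (1 - wu) * ws ^ 2 + (9 : ℝ) * q ^ 2 * (1 - q) * (1 - wg) ^ 2 * wu ^ 2 * ws ^ 2 +
      (4 : ℝ) * q ^ 2 * (1 - q) * wg * (1 - wg) * wu * (1 - wu) * ws ^ 2 + (18 : ℝ) * q ^ 2 * (1 - q) * wg * (1 - wg) * wu ^ 2 * ws ^ 2 +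
      (4 : ℝ) * q ^ 2 * (1 - q) * wg ^ 2 * (1 - wu) ^ 2 * (1 - ws) ^ 2 + (8 : ℝ) * q ^ 2 * (1 - q) * wg ^ 2 * (1 - wu) ^ 2 * ws * (1 - ws) +
      (4 : ℝ) * q ^ 2 * (1 - q) * wg ^ 2 * wu * (1 - wu) * (1 - ws) ^ 2 + (4 : ℝ) * q ^ 2 * (1 - q) * wg ^ 2 * wu * (1 - wu) * ws * (1 - ws) +
      (5 : ℝ) * q ^ 2 * (1 - q) * wg ^ 2 * wu ^ 2 * ws ^ 2 + (2 : ℝ) * q ^ 3 * (1 - wg) ^ 2 * wu * (1 - wu) * ws ^ 2 + (2 : ℝ) * q ^ 3 * (1 - wg) ^ 2 * wu ^ 2 * ws ^ 2 +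
      (4 : ℝ) * q ^ 3 * wg * (1 - wg) * wu ^ 2 * ws ^ 2 + (1 : ℝ) * q ^ 3 * wg ^ 2 * (1 - wu) ^ 2 * (1 - ws) ^ 2 + (2 : ℝ) * q ^ 3 * wg ^ 2 * (1 - wu) ^ 2 * ws * (1 - ws) +
      (2 : ℝ) * q ^ 3 * wg ^ 2 * wu * (1 - wu) * (1 - ws) ^ 2 + (1 : ℝ) * q ^ 3 * wg ^ 2 * wu ^ 2 * ws ^ 2 := by
    simp only [mfConeR100]; ring
  rw [e]; positivity

set_option maxHeartbeats 1500000 in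
/-- `mfConeQone ≥ 0` on `[0,1]³` (tensor-Bernstein certificate). [folklore] -/
theorem mfConeQone_nonneg {q wu ws : ℝ} (hq0 : 0 ≤ q) (hq1 : q ≤ 1) (hwu0 : 0 ≤ wu) (hwu1 : wu ≤ 1) (hws0 : 0 ≤ ws) (hws1 : ws ≤ 1) :
    0 ≤ mfConeQone q wu ws := by
  have hq1' : (0:ℝ) ≤ 1 - q := sub_nonneg.2 hq1
  have hwu1' : (0:ℝ) ≤ 1 - wu := sub_nonneg.2 hwu1
  have hws1' : (0:ℝ) ≤ 1 - ws := sub_nonneg.2 hws1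
  have e : mfConeQone q wu ws =
      (8 : ℝ) * (1 - q) ^ 3 * (1 - wu) ^ 2 * (1 - ws) ^ 2 + (16 : ℝ) * (1 - q) ^ 3 * (1 - wu) ^ 2 * ws * (1 - ws) + (4 : ℝ) * (1 - q) ^ 3 * (1 - wu) ^ 2 * ws ^ 2 +
      (16 : ℝ) * (1 - q) ^ 3 * wu * (1 - wu) * (1 - ws) ^ 2 + (24 : ℝ) * (1 - q) ^ 3 * wu * (1 - wu) * ws * (1 - ws) + (4 : ℝ) * (1 - q) ^ 3 * wu ^ 2 * (1 - ws) ^ 2 +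
      (8 : ℝ) * (1 - q) ^ 3 * wu ^ 2 * ws * (1 - ws) + (4 : ℝ) * (1 - q) ^ 3 * wu ^ 2 * ws ^ 2 + (16 : ℝ) * q * (1 - q) ^ 2 * (1 - wu) ^ 2 * (1 - ws) ^ 2 +
      (32 : ℝ) * q * (1 - q) ^ 2 * (1 - wu) ^ 2 * ws * (1 - ws) + (8 : ℝ) * q * (1 - q) ^ 2 * (1 - wu) ^ 2 * ws ^ 2 + (24 : ℝ) * q * (1 - q) ^ 2 * wu * (1 - wu) * (1 - ws) ^ 2 +
      (28 : ℝ) * q * (1 - q) ^ 2 * wu * (1 - wu) * ws * (1 - ws) + (4 : ℝ) * q * (1 - q) ^ 2 * wu ^ 2 * (1 - ws) ^ 2 + (8 : ℝ) * q * (1 - q) ^ 2 * wu ^ 2 * ws * (1 - ws) +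
      (8 : ℝ) * q * (1 - q) ^ 2 * wu ^ 2 * ws ^ 2 + (10 : ℝ) * q ^ 2 * (1 - q) * (1 - wu) ^ 2 * (1 - ws) ^ 2 + (20 : ℝ) * q ^ 2 * (1 - q) * (1 - wu) ^ 2 * ws * (1 - ws) +
      (5 : ℝ) * q ^ 2 * (1 - q) * (1 - wu) ^ 2 * ws ^ 2 + (12 : ℝ) * q ^ 2 * (1 - q) * wu * (1 - wu) * (1 - ws) ^ 2 + (8 : ℝ) * q ^ 2 * (1 - q) * wu * (1 - wu) * ws * (1 - ws) +
      (1 : ℝ) * q ^ 2 * (1 - q) * wu ^ 2 * (1 - ws) ^ 2 + (2 : ℝ) * q ^ 2 * (1 - q) * wu ^ 2 * ws * (1 - ws) + (5 : ℝ) * q ^ 2 * (1 - q) * wu ^ 2 * ws ^ 2 +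
      (2 : ℝ) * q ^ 3 * (1 - wu) ^ 2 * (1 - ws) ^ 2 + (4 : ℝ) * q ^ 3 * (1 - wu) ^ 2 * ws * (1 - ws) + (1 : ℝ) * q ^ 3 * (1 - wu) ^ 2 * ws ^ 2 +
      (2 : ℝ) * q ^ 3 * wu * (1 - wu) * (1 - ws) ^ 2 + (1 : ℝ) * q ^ 3 * wu ^ 2 * ws ^ 2 := by
    simp only [mfConeQone]; ring
  rw [e]; positivity

set_option maxHeartbeats 4000000 in
/-- `mfConeE ≥ 0` on `[0,1]³` (tensor-Bernstein certificate). [folklore] -/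
theorem mfConeE_nonneg {q wu ws : ℝ} (hq0 : 0 ≤ q) (hq1 : q ≤ 1) (hwu0 : 0 ≤ wu) (hwu1 : wu ≤ 1) (hws0 : 0 ≤ ws) (hws1 : ws ≤ 1) :
    0 ≤ mfConeE q wu ws := by
  have hq1' : (0:ℝ) ≤ 1 - q := sub_nonneg.2 hq1
  have hwu1' : (0:ℝ) ≤ 1 - wu := sub_nonneg.2 hwu1
  have hws1' : (0:ℝ) ≤ 1 - ws := sub_nonneg.2 hws1
  have e : mfConeE q wu ws =
      (16 : ℝ) * (1 - q) ^ 6 * wu * (1 - wu) ^ 2 * (1 - ws) ^ 2 + (32 : ℝ) * (1 - q) ^ 6 * wu * (1 - wu) ^ 2 * ws * (1 - ws) + (48 : ℝ) * (1 - q) ^ 6 * wu ^ 2 * (1 - wu) * (1 - ws) ^ 2 +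
      (96 : ℝ) * (1 - q) ^ 6 * wu ^ 2 * (1 - wu) * ws * (1 - ws) + (16 : ℝ) * (1 - q) ^ 6 * wu ^ 2 * (1 - wu) * ws ^ 2 + (16 : ℝ) * (1 - q) ^ 6 * wu ^ 3 * (1 - ws) ^ 2 +
      (48 : ℝ) * (1 - q) ^ 6 * wu ^ 3 * ws * (1 - ws) + (16 : ℝ) * (1 - q) ^ 6 * wu ^ 3 * ws ^ 2 + (64 : ℝ) * q * (1 - q) ^ 5 * (1 - wu) ^ 3 * (1 - ws) ^ 2 +
      (128 : ℝ) * q * (1 - q) ^ 5 * (1 - wu) ^ 3 * ws * (1 - ws) + (32 : ℝ) * q * (1 - q) ^ 5 * (1 - wu) ^ 3 * ws ^ 2 +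
      (224 : ℝ) * q * (1 - q) ^ 5 * wu * (1 - wu) ^ 2 * (1 - ws) ^ 2 + (432 : ℝ) * q * (1 - q) ^ 5 * wu * (1 - wu) ^ 2 * ws * (1 - ws) +
      (64 : ℝ) * q * (1 - q) ^ 5 * wu * (1 - wu) ^ 2 * ws ^ 2 + (240 : ℝ) * q * (1 - q) ^ 5 * wu ^ 2 * (1 - wu) * (1 - ws) ^ 2 +
      (488 : ℝ) * q * (1 - q) ^ 5 * wu ^ 2 * (1 - wu) * ws * (1 - ws) + (88 : ℝ) * q * (1 - q) ^ 5 * wu ^ 2 * (1 - wu) * ws ^ 2 + (64 : ℝ) * q * (1 - q) ^ 5 * wu ^ 3 * (1 - ws) ^ 2 +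
      (224 : ℝ) * q * (1 - q) ^ 5 * wu ^ 3 * ws * (1 - ws) + (80 : ℝ) * q * (1 - q) ^ 5 * wu ^ 3 * ws ^ 2 + (192 : ℝ) * q ^ 2 * (1 - q) ^ 4 * (1 - wu) ^ 3 * (1 - ws) ^ 2 +
      (384 : ℝ) * q ^ 2 * (1 - q) ^ 4 * (1 - wu) ^ 3 * ws * (1 - ws) + (96 : ℝ) * q ^ 2 * (1 - q) ^ 4 * (1 - wu) ^ 3 * ws ^ 2 +
      (528 : ℝ) * q ^ 2 * (1 - q) ^ 4 * wu * (1 - wu) ^ 2 * (1 - ws) ^ 2 + (960 : ℝ) * q ^ 2 * (1 - q) ^ 4 * wu * (1 - wu) ^ 2 * ws * (1 - ws) +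
      (148 : ℝ) * q ^ 2 * (1 - q) ^ 4 * wu * (1 - wu) ^ 2 * ws ^ 2 + (384 : ℝ) * q ^ 2 * (1 - q) ^ 4 * wu ^ 2 * (1 - wu) * (1 - ws) ^ 2 +
      (776 : ℝ) * q ^ 2 * (1 - q) ^ 4 * wu ^ 2 * (1 - wu) * ws * (1 - ws) + (144 : ℝ) * q ^ 2 * (1 - q) ^ 4 * wu ^ 2 * (1 - wu) * ws ^ 2 +
      (88 : ℝ) * q ^ 2 * (1 - q) ^ 4 * wu ^ 3 * (1 - ws) ^ 2 + (404 : ℝ) * q ^ 2 * (1 - q) ^ 4 * wu ^ 3 * ws * (1 - ws) + (164 : ℝ) * q ^ 2 * (1 - q) ^ 4 * wu ^ 3 * ws ^ 2 +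
      (224 : ℝ) * q ^ 3 * (1 - q) ^ 3 * (1 - wu) ^ 3 * (1 - ws) ^ 2 + (448 : ℝ) * q ^ 3 * (1 - q) ^ 3 * (1 - wu) ^ 3 * ws * (1 - ws) +
      (112 : ℝ) * q ^ 3 * (1 - q) ^ 3 * (1 - wu) ^ 3 * ws ^ 2 + (544 : ℝ) * q ^ 3 * (1 - q) ^ 3 * wu * (1 - wu) ^ 2 * (1 - ws) ^ 2 +
      (896 : ℝ) * q ^ 3 * (1 - q) ^ 3 * wu * (1 - wu) ^ 2 * ws * (1 - ws) + (144 : ℝ) * q ^ 3 * (1 - q) ^ 3 * wu * (1 - wu) ^ 2 * ws ^ 2 +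
      (288 : ℝ) * q ^ 3 * (1 - q) ^ 3 * wu ^ 2 * (1 - wu) * (1 - ws) ^ 2 + (548 : ℝ) * q ^ 3 * (1 - q) ^ 3 * wu ^ 2 * (1 - wu) * ws * (1 - ws) +
      (124 : ℝ) * q ^ 3 * (1 - q) ^ 3 * wu ^ 2 * (1 - wu) * ws ^ 2 + (56 : ℝ) * q ^ 3 * (1 - q) ^ 3 * wu ^ 3 * (1 - ws) ^ 2 +
      (388 : ℝ) * q ^ 3 * (1 - q) ^ 3 * wu ^ 3 * ws * (1 - ws) + (188 : ℝ) * q ^ 3 * (1 - q) ^ 3 * wu ^ 3 * ws ^ 2 + (128 : ℝ) * q ^ 4 * (1 - q) ^ 2 * (1 - wu) ^ 3 * (1 - ws) ^ 2 +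
      (256 : ℝ) * q ^ 4 * (1 - q) ^ 2 * (1 - wu) ^ 3 * ws * (1 - ws) + (64 : ℝ) * q ^ 4 * (1 - q) ^ 2 * (1 - wu) ^ 3 * ws ^ 2 +
      (290 : ℝ) * q ^ 4 * (1 - q) ^ 2 * wu * (1 - wu) ^ 2 * (1 - ws) ^ 2 + (412 : ℝ) * q ^ 4 * (1 - q) ^ 2 * wu * (1 - wu) ^ 2 * ws * (1 - ws) +
      (73 : ℝ) * q ^ 4 * (1 - q) ^ 2 * wu * (1 - wu) ^ 2 * ws ^ 2 + (116 : ℝ) * q ^ 4 * (1 - q) ^ 2 * wu ^ 2 * (1 - wu) * (1 - ws) ^ 2 +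
      (176 : ℝ) * q ^ 4 * (1 - q) ^ 2 * wu ^ 2 * (1 - wu) * ws * (1 - ws) + (64 : ℝ) * q ^ 4 * (1 - q) ^ 2 * wu ^ 2 * (1 - wu) * ws ^ 2 +
      (17 : ℝ) * q ^ 4 * (1 - q) ^ 2 * wu ^ 3 * (1 - ws) ^ 2 + (214 : ℝ) * q ^ 4 * (1 - q) ^ 2 * wu ^ 3 * ws * (1 - ws) + (124 : ℝ) * q ^ 4 * (1 - q) ^ 2 * wu ^ 3 * ws ^ 2 +
      (36 : ℝ) * q ^ 5 * (1 - q) * (1 - wu) ^ 3 * (1 - ws) ^ 2 + (72 : ℝ) * q ^ 5 * (1 - q) * (1 - wu) ^ 3 * ws * (1 - ws) + (18 : ℝ) * q ^ 5 * (1 - q) * (1 - wu) ^ 3 * ws ^ 2 +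
      (78 : ℝ) * q ^ 5 * (1 - q) * wu * (1 - wu) ^ 2 * (1 - ws) ^ 2 + (92 : ℝ) * q ^ 5 * (1 - q) * wu * (1 - wu) ^ 2 * ws * (1 - ws) +
      (19 : ℝ) * q ^ 5 * (1 - q) * wu * (1 - wu) ^ 2 * ws ^ 2 + (28 : ℝ) * q ^ 5 * (1 - q) * wu ^ 2 * (1 - wu) * (1 - ws) ^ 2 +
      (20 : ℝ) * q ^ 5 * (1 - q) * wu ^ 2 * (1 - wu) * ws * (1 - ws) + (18 : ℝ) * q ^ 5 * (1 - q) * wu ^ 2 * (1 - wu) * ws ^ 2 + (2 : ℝ) * q ^ 5 * (1 - q) * wu ^ 3 * (1 - ws) ^ 2 +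
      (64 : ℝ) * q ^ 5 * (1 - q) * wu ^ 3 * ws * (1 - ws) + (43 : ℝ) * q ^ 5 * (1 - q) * wu ^ 3 * ws ^ 2 + (4 : ℝ) * q ^ 6 * (1 - wu) ^ 3 * (1 - ws) ^ 2 +
      (8 : ℝ) * q ^ 6 * (1 - wu) ^ 3 * ws * (1 - ws) + (2 : ℝ) * q ^ 6 * (1 - wu) ^ 3 * ws ^ 2 + (8 : ℝ) * q ^ 6 * wu * (1 - wu) ^ 2 * (1 - ws) ^ 2 +
      (8 : ℝ) * q ^ 6 * wu * (1 - wu) ^ 2 * ws * (1 - ws) + (2 : ℝ) * q ^ 6 * wu * (1 - wu) ^ 2 * ws ^ 2 + (4 : ℝ) * q ^ 6 * wu ^ 2 * (1 - wu) * (1 - ws) ^ 2 +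
      (2 : ℝ) * q ^ 6 * wu ^ 2 * (1 - wu) * ws ^ 2 + (8 : ℝ) * q ^ 6 * wu ^ 3 * ws * (1 - ws) + (6 : ℝ) * q ^ 6 * wu ^ 3 * ws ^ 2 := by
    simp only [mfConeE]; ring
  rw [e]; positivity

set_option maxHeartbeats 4000000 in
/-- **`mfConeR101 ≥ 0` on `[0,1]⁴`** — the one coefficient without a Bernstein certificate (zero lines `{q=1,w_u=1,w_s=0}`, `{w_u=0,w_g=0}`):
`R₁₀₁ = q·Q` with `Q = C(1−w_g)² + 2Q_m w_g(1−w_g) + Q₁w_g²`, `C = w_s²w_u(2−q)²(2q+(1−q)w_u) ≥ 0`, `Q₁ = mfConeQone ≥ 0`, `Q_m = w_s w_u M`; if `M ≥ 0` all three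
Bernstein coefficients are `≥ 0`, and if `M < 0` then `C·Q₁ − Q_m² = w_s²w_u·(mfConeE − 4w_u²M) ≥ 0`, so `|2Q_m w_g(1−w_g)| ≤ C(1−w_g)² + Q₁w_g²`. [folklore] -/
theorem mfConeR101_nonneg {q wg wu ws : ℝ} (hq0 : 0 ≤ q) (hq1 : q ≤ 1) (hwg0 : 0 ≤ wg) (hwg1 : wg ≤ 1) (hwu0 : 0 ≤ wu) (hwu1 : wu ≤ 1) (hws0 : 0 ≤ ws)
    (hws1 : ws ≤ 1) : 0 ≤ mfConeR101 q wg wu ws := by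
  have hq1' : (0:ℝ) ≤ 1 - q := sub_nonneg.2 hq1
  have hq2 : (0:ℝ) ≤ 2 - q := by linarith
  have hwg1' : (0:ℝ) ≤ 1 - wg := sub_nonneg.2 hwg1
  have hwu1' : (0:ℝ) ≤ 1 - wu := sub_nonneg.2 hwu1
  have hQ1 := mfConeQone_nonneg hq0 hq1 hwu0 hwu1 hws0 hws1
  have hE := mfConeE_nonneg hq0 hq1 hwu0 hwu1 hws0 hws1
  set M : ℝ := ws * (2 - q) ^ 2 * (2 * q + (1 - q) * wu) - 2 * (1 - wu) * (2 * (1 - q) + q * ws) with hMdef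
  set Cc : ℝ := ws ^ 2 * wu * (2 - q) ^ 2 * (2 * q + (1 - q) * wu) with hCdef
  have hC : 0 ≤ Cc := by rw [hCdef]; positivity
  set a : ℝ := Cc * (1 - wg) ^ 2 + mfConeQone q wu ws * wg ^ 2 with hadef
  set b : ℝ := 2 * (ws * wu * M) * wg * (1 - wg) with hbdef
  have ha : 0 ≤ a := by rw [hadef]; positivity
  have key : mfConeR101 q wg wu ws = q * (a + b) := by
    simp only [hadef, hbdef, hCdef, hMdef, mfConeR101, mfConeQone]; ring
  rw [key]
  refine mul_nonneg hq0 ?_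
  rcases le_total 0 M with hM | hM
  · have hb : 0 ≤ b := by rw [hbdef]; positivity
    linarith
  · have hwu2M : 0 ≤ wu ^ 2 * (-M) := mul_nonneg (sq_nonneg _) (by linarith)
    have hD : 0 ≤ mfConeE q wu ws - 4 * wu ^ 2 * M := by nlinarith
    have i2 : Cc * mfConeQone q wu ws - (ws * wu * M) ^ 2 = ws ^ 2 * wu * (mfConeE q wu ws - 4 * wu ^ 2 * M) := by
      simp only [hCdef, hMdef, mfConeQone, mfConeE]; ring
    have hD2 : (ws * wu * M) ^ 2 ≤ Cc * mfConeQone q wu ws := by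
      have : 0 ≤ ws ^ 2 * wu * (mfConeE q wu ws - 4 * wu ^ 2 * M) := by positivity
      linarith
    have h3 : b ^ 2 = 4 * (ws * wu * M) ^ 2 * (wg * (1 - wg)) ^ 2 := by rw [hbdef]; ring
    have h4 : a ^ 2 - 4 * (Cc * mfConeQone q wu ws) * (wg * (1 - wg)) ^ 2 = (Cc * (1 - wg) ^ 2 - mfConeQone q wu ws * wg ^ 2) ^ 2 := by
      rw [hadef]; ring
    have hsq : b ^ 2 ≤ a ^ 2 := by
      have h5 : 4 * (ws * wu * M) ^ 2 * (wg * (1 - wg)) ^ 2 ≤ 4 * (Cc * mfConeQone q wu ws) * (wg * (1 - wg)) ^ 2 :=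
        mul_le_mul_of_nonneg_right (by linarith) (sq_nonneg _)
      nlinarith [sq_nonneg (Cc * (1 - wg) ^ 2 - mfConeQone q wu ws * wg ^ 2)]
    obtain ⟨h6, -⟩ := abs_le_of_sq_le_sq' hsq ha
    linarith

set_option maxHeartbeats 1500000 in
/-- `mfConeR102 ≥ 0` on the box `q, w_g, w_u, w_s ∈ [0,1]` (explicit non-negative certificate, checked by `ring` + `positivity`). [folklore] -/
theorem mfConeR102_nonneg {q wg wu : ℝ} (hq0 : 0 ≤ q) (hq1 : q ≤ 1) (hwu0 : 0 ≤ wu) (hwu1 : wu ≤ 1) : 0 ≤ mfConeR102 q wg wu := by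
  have hq1' : (0:ℝ) ≤ 1 - q := sub_nonneg.2 hq1
  have hwu1' : (0:ℝ) ≤ 1 - wu := sub_nonneg.2 hwu1
  have e : mfConeR102 q wg wu =
      (4 : ℝ) * q ^ 2 * (1 - q) ^ 2 * wg ^ 2 * (1 - wu) ^ 2 + (5 : ℝ) * q ^ 3 * (1 - q) * wg ^ 2 * (1 - wu) ^ 2 + (2 : ℝ) * q ^ 3 * (1 - q) * wg ^ 2 * wu * (1 - wu) +
      (1 : ℝ) * q ^ 3 * (1 - q) * wg ^ 2 * wu ^ 2 + (1 : ℝ) * q ^ 4 * wg ^ 2 * (1 - wu) ^ 2 := by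
    simp only [mfConeR102]; ring
  rw [e]; positivity

set_option maxHeartbeats 1500000 in
/-- `mfConeR110 ≥ 0` on the box `q, w_g, w_u, w_s ∈ [0,1]` (explicit non-negative certificate, checked by `ring` + `positivity`). [folklore] -/
theorem mfConeR110_nonneg {q wg wu ws : ℝ} (hq0 : 0 ≤ q) (hq1 : q ≤ 1) (hwg0 : 0 ≤ wg) (hwg1 : wg ≤ 1) (hwu0 : 0 ≤ wu) (hwu1 : wu ≤ 1) (hws0 : 0 ≤ ws) (hws1 : ws ≤ 1) : 0 ≤ mfConeR110 q wg wu ws := by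
  have hq1' : (0:ℝ) ≤ 1 - q := sub_nonneg.2 hq1
  have hwg1' : (0:ℝ) ≤ 1 - wg := sub_nonneg.2 hwg1
  have hwu1' : (0:ℝ) ≤ 1 - wu := sub_nonneg.2 hwu1
  have hws1' : (0:ℝ) ≤ 1 - ws := sub_nonneg.2 hws1
  have e : mfConeR110 q wg wu ws =
      (4 : ℝ) * (wg - ws) ^ 2 * q * (1 - q) ^ 2 * (1 - wu) ^ 2 + (12 : ℝ) * (wg - ws) ^ 2 * q * (1 - q) ^ 2 * wu * (1 - wu) + (4 : ℝ) * (wg - ws) ^ 2 * q * (1 - q) ^ 2 * wu ^ 2 +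
      (2 : ℝ) * (wg - ws) ^ 2 * q ^ 2 * (1 - q) * (1 - wu) ^ 2 + (8 : ℝ) * (wg - ws) ^ 2 * q ^ 2 * (1 - q) * wu * (1 - wu) + (2 : ℝ) * (wg - ws) ^ 2 * q ^ 2 * (1 - q) * wu ^ 2 +
      (4 : ℝ) * q * (1 - q) ^ 2 * (1 - wg) ^ 2 * wu * (1 - wu) * ws ^ 2 + (8 : ℝ) * q * (1 - q) ^ 2 * (1 - wg) ^ 2 * wu ^ 2 * ws ^ 2 +
      (8 : ℝ) * q * (1 - q) ^ 2 * wg * (1 - wg) * wu * (1 - wu) * ws ^ 2 + (16 : ℝ) * q * (1 - q) ^ 2 * wg * (1 - wg) * wu ^ 2 * ws ^ 2 +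
      (4 : ℝ) * q * (1 - q) ^ 2 * wg ^ 2 * (1 - wu) ^ 2 * (1 - ws) ^ 2 + (8 : ℝ) * q * (1 - q) ^ 2 * wg ^ 2 * (1 - wu) ^ 2 * ws * (1 - ws) +
      (4 : ℝ) * q * (1 - q) ^ 2 * wg ^ 2 * wu * (1 - wu) * (1 - ws) ^ 2 + (8 : ℝ) * q * (1 - q) ^ 2 * wg ^ 2 * wu * (1 - wu) * ws * (1 - ws) +
      (4 : ℝ) * q * (1 - q) ^ 2 * wg ^ 2 * wu ^ 2 * ws ^ 2 + (2 : ℝ) * q ^ 2 * (1 - q) * (1 - wg) ^ 2 * (1 - wu) ^ 2 * ws ^ 2 +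
      (8 : ℝ) * q ^ 2 * (1 - q) * (1 - wg) ^ 2 * wu * (1 - wu) * ws ^ 2 + (10 : ℝ) * q ^ 2 * (1 - q) * (1 - wg) ^ 2 * wu ^ 2 * ws ^ 2 +
      (4 : ℝ) * q ^ 2 * (1 - q) * wg * (1 - wg) * wu * (1 - wu) * ws ^ 2 + (16 : ℝ) * q ^ 2 * (1 - q) * wg * (1 - wg) * wu ^ 2 * ws ^ 2 +
      (6 : ℝ) * q ^ 2 * (1 - q) * wg ^ 2 * (1 - wu) ^ 2 * (1 - ws) ^ 2 + (8 : ℝ) * q ^ 2 * (1 - q) * wg ^ 2 * (1 - wu) ^ 2 * ws * (1 - ws) +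
      (8 : ℝ) * q ^ 2 * (1 - q) * wg ^ 2 * wu * (1 - wu) * (1 - ws) ^ 2 + (4 : ℝ) * q ^ 2 * (1 - q) * wg ^ 2 * wu * (1 - wu) * ws * (1 - ws) +
      (2 : ℝ) * q ^ 2 * (1 - q) * wg ^ 2 * wu ^ 2 * (1 - ws) ^ 2 + (4 : ℝ) * q ^ 2 * (1 - q) * wg ^ 2 * wu ^ 2 * ws ^ 2 + (1 : ℝ) * q ^ 3 * (1 - wg) ^ 2 * (1 - wu) ^ 2 * ws ^ 2 +
      (4 : ℝ) * q ^ 3 * (1 - wg) ^ 2 * wu * (1 - wu) * ws ^ 2 + (3 : ℝ) * q ^ 3 * (1 - wg) ^ 2 * wu ^ 2 * ws ^ 2 + (4 : ℝ) * q ^ 3 * wg * (1 - wg) * wu ^ 2 * ws ^ 2 +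
      (2 : ℝ) * q ^ 3 * wg ^ 2 * (1 - wu) ^ 2 * (1 - ws) ^ 2 + (2 : ℝ) * q ^ 3 * wg ^ 2 * (1 - wu) ^ 2 * ws * (1 - ws) + (4 : ℝ) * q ^ 3 * wg ^ 2 * wu * (1 - wu) * (1 - ws) ^ 2 +
      (1 : ℝ) * q ^ 3 * wg ^ 2 * wu ^ 2 * (1 - ws) ^ 2 + (1 : ℝ) * q ^ 3 * wg ^ 2 * wu ^ 2 * ws ^ 2 := by
    simp only [mfConeR110]; ring
  rw [e]; positivity

end ThreeApex

end FK

end Summit.CriticalPhenomena.PercolationContinuityZ3.Theorems
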